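/-
Copyright (c) 2026 the pub-hodgecm-mathlib formalisation cell (harness21).  Prover seat hodgecm-mathlib-K2E2-p12 (g10), Track B «K2-LIT», h413 = `stmt-HodgeConjecture-24833`,
route `HCCMUnconditional`; R90-TF section S8 «ContSpec-n½», deal S8-R247 (1) (S8 dealer R90-CS-plan (g3)): (R)′τ OF RECORD, SECOND EDITION — `resGMidBlockτ ≤ L²_res(𝔓)` with the
rows bound BY NAME where ★ (hEXP ← ★ p864795 of `hCO`, hCONT ← ★ p864638 of `hTEXP6`, hSCAL ← ★ `amplitudeRows_of_unfolding` of `hUNF`, hSCAT ← ★ p864880's Euler head + an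
in-file junction), over a NEW τ-spine without `hW1`; census `R90/S8/CENSUS-RprimeV2.K2E2-p12-g10.md` e1905b86c9457d43.
-/
import Summits.HodgeConjecture.HodgeConjecture.Theorems.R90S8ResGMidBlockLeResidualOfTauAdmissibleU3         -- ★ p864188 (K2E1-p10): the τ-frame; brings ★ (R)′ OF RECORD ed. 1 p863946 (`scalPackage_of_inputs`) and the whole (R)′ engine, ★ typ2 τ-defs
import Summits.HodgeConjecture.HodgeConjecture.Theorems.R90S8ResGMidRowsOfTauExportsClosedU3                 -- ★ p864795 (K2E1-p12 g6): `hEXP_tauRow_closed'` (of `hCO`)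
import Summits.HodgeConjecture.HodgeConjecture.Theorems.R90S8ResGMidHContRowsFreeU3                           -- ★ p864638 (K2E1-p11): `hCONT_tauRow_of_truncatedExportsRow` (of `hTEXP6`)
import Summits.HodgeConjecture.HodgeConjecture.Theorems.K2E1ChiScalarRowsOfRecordU3                           -- ★ (K2E1-p11): `amplitudeRows_of_unfolding`; brings ★ `scalarRatio_one_ne_zero`
import Summits.HodgeConjecture.HodgeConjecture.Theorems.K2E1ChiScatteringCoordsEulerFactorisationKFiniteCMThree  -- ★ p864880 (this seat): `exists_eulerFactorisation_of_tubeClause`; brings ★ `codiscrete_union`, ★ connectedness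
import HarnessLib

/-!
# S8 sub-socket (R)′ — `R90S8ResGMidBlockLeResidualOfRecordV2U3`: (R)′τ OF RECORD, SECOND EDITION — `resGMidBlockτ ξ μω ≤ L²_res(𝔓)` WITH THE ROWS BOUND BY NAME, OVER A τ-SPINE WITHOUT `hW1`

Track B ∕ R90-TF, crux h413 = `stmt-HodgeConjecture-24833`, route `HCCMUnconditional`; cell `hodgecm-mathlib`, S8 «ContSpec-n½», sub-socket (R) `sock_S8_res_midBlock_le_residual` ((R)′, B ED. 7
:337) and K2E1-p13 (g6)'s (V♭)τ assembly (binder `hRes`, ★ p864915 :279).  THEOREMS ONLY (no `def`∕`instance`∕`notation`, no named-fact hypothesis, no `sorry`, default heartbeats); lane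
`--supports … --as helper`; CLOSES NO SOCKET — composition, not payment.

WHAT CHANGES FROM ED. 1 (★ p863946 ∕ ★ p864188).  (a) THE τ-SPINE: `resGMidBlockτ = hull ⋃_{τ-levels} closure(span genτ)` lies in `L²_res = L²_disc ⊓ (L²_cusp)ᗮ` as soon as every
τ-GENERATOR does (★ `resGMidBlockτ_le`, closure minimality): the disc half is ★ `hdisc_of_admissible hDISC` (L1, once) through ★ `resGMidAtomτ_le_resGMidAtom`; the cusp half is ed. 1's
per-generator chain VERBATIM at `(tauLevel U₀, 1)` (★ `roadData_of_tubeLetters` ∘ ★ `scalPackage_of_inputs` ∘ ★ `ctPackage_of_scalarRoad` ∘ ★ `opRoadPackage_of_letters` ∘ ★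
`hseed_of_resGMidAtomGen_clauses` ∘ ★ `inner_cuspFormsToLp_eq_zero_of_midResidue_letters`) — so the τ-head needs NO `hW1`; (R)′ itself is the one-line corollary under `hW1`.  (b) ROWS BY
NAME: `hEXP := ★ hEXP_tauRow_closed' … hμu hCO` (p864795; visible ONCE: the exports frame, the ports' Haar frame `μa μf`, the restricted co-weight line `hCO`); `hCONT := ★
hCONT_tauRow_of_truncatedExportsRow … hTEXP6` (p864638; visible: the exports-WITH-(E6) τ-row `hTEXP6` — NOT closed from `hCO` tonight: the closed chain ★ p864795 §4 ∘ ★ p864499 §6 is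
(E6)-free and the block letter `hBLOCK` is payable at pure-type generators only; the gap is «(E6)-additivity over pure pieces», named in the census); `hSCALrows` per generator := ★
`amplitudeRows_of_unfolding` at the scalar of record (★ `scalarRatio_one_ne_zero`) of the UNFOLDING letter `hUNF`; the F5 block ONCE at `cS :=` ★ F5's ratio (`hq := hsrc`).  (c) hSCAT per
generator: columns `hCOLS` (the un-projected K-finite export tuple — ED. 2 removes it by index concatenation over pure pieces), the Euler factorisation ★ p864880
`exists_eulerFactorisation_of_tubeClause` of `hunfK` AT THE SCALAR OF RECORD, the junction `qcv_j = qc·(a_j∕A)` near `3∕2` PROVED HERE (§1, identity theorem on `{1<Re} ∖ (P ∪ P′)`),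
OFF-AXIS pole exclusion `hPreal` (the continued coordinates are analytic at every non-real point of `{1<Re}`, so holomorphic on both quarter planes — all that ★
`exists_hSCAT_of_factorisation` uses; ed. 1's «`P′` real» clause is thereby avoided), and axis reality `hreal` of the closed-formula `wc`.
* §1 **`eventuallyEq_coord_of_junction`** — the Euler junction near `3∕2` (generic).
* §2 HEAD **`resGMidBlockτ_le_residual_of_record_v2`** ⊢ `resGMidBlockτ L μ ξ μω ≤ residualSubspace … μ 𝔓` (K2E1-p13's `hRes`: apply `ClosedSubrep.toSubmodule_le_iff`); (R)′'s body follows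
  under `hW1` by `hW1.trans`.
NET LETTER LIST (census (5)): ONCE {`hDISC` (L1), F5 block ((V) (iii) bytes), `hCO` + exports frame + ports' Haar frame}; PER τ-GENERATOR {`hTEXP6`, `hUNF`, `hCOLS`, `hunfK` (scalar of
record), `hPreal`, `hreal`}.  Everything else is ★ by name.
HONEST LABEL: HC_CM is proved only modulo the 7 printed citations (2 remaining named inputs: hLiu418 = `stmt-HodgeConjecture-24832`, h413 = `stmt-HodgeConjecture-24833`) until
rung 0 closes; REL ≠ ★ ≠ BUILT; this file asserts no named fact, is conditional by construction on the letters it names, and closes no socket; count-neutral.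

## References
* [MoeglinWaldspurger1995] C. Mœglin, J.-L. Waldspurger, *Spectral Decomposition and Eisenstein Series* (1995), I.2.18, II.1.7, IV.1.9–IV.1.11, IV.2.3, V.3.13.
* [Langlands1976] R. P. Langlands, *On the Functional Equations Satisfied by Eisenstein Series*, LNM 544 (1976), §6–§7.
* [Rogawski1990] J. D. Rogawski, *Automorphic Representations of Unitary Groups in Three Variables* (1990), §13.9 p. 229 (ii).
* [BernsteinLapid2019] J. Bernstein, E. Lapid, *On the meromorphic continuation of Eisenstein series*, J. AMS 37 (2024), §4, §7.
-/

set_option autoImplicit false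
set_option linter.dupNamespace false  -- the mandated namespace `…HodgeConjecture.HodgeConjecture.R90.S8` (LEAD #1 L1) repeats the summit's segment

noncomputable section

open MeasureTheory Measure NumberField IsDedekindDomain Set Filter Topology ContRepresentation
open scoped ENNReal NNReal ComplexConjugate InnerProductSpace Topology
open Literature.NumberTheory Literature.NumberTheory.Automorphic Literature.NumberTheory.Automorphic.UnitaryGroup Literature.NumberTheory.GaloisRepresentations AdelicGroupData
open Literature.NumberTheory.Automorphic.Arthur2013.Leaves.TECR Literature.NumberTheory.Rogawski1990 Literature.NumberTheory.LFunctions Literature.MeasureTheory.Group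
open Summit.HodgeConjecture.HodgeConjecture.Cruxes.H413.K2E1BorelEisensteinU Summit.HodgeConjecture.HodgeConjecture.Cruxes.H413.K2E1CharacterEisensteinU2Defs
open Summit.HodgeConjecture.HodgeConjecture.Cruxes.H413.K2E1CharacterEisensteinU3PairDefs Summit.HodgeConjecture.HodgeConjecture.Cruxes.H413.K2E1ChiSectionSpaceU3PairDefs Summit.HodgeConjecture.HodgeConjecture.Cruxes.H413.K2E1BLBorelSpacesU2Defs
open Summit.HodgeConjecture.HodgeConjecture.Cruxes.H413.K2E1BLBorelOperatorsU2Defs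
open Summit.HodgeConjecture.HodgeConjecture.Cruxes.H413.K2E1CuspidalSpectrumUnitary (residualSubspace toSubmodule_residualPart)
open Summit.HodgeConjecture.HodgeConjecture.Cruxes.H413.K2E1ChiScatteringMiddlePoleU3 (exists_residue_at_threeHalves_cm_three)
open Summit.HodgeConjecture.HodgeConjecture.Cruxes.H413.K2E1SphericalEisensteinResidueConstantCMThreeOfLetters (exists_analyticAt_eventuallyEq_mul_sub_of_tendsto)
open Summit.HodgeConjecture.HodgeConjecture.Cruxes.H413.R90S8ResGMidBlockScatteringOfRecordU3 (exists_hSCAT_of_factorisation integrable_restrict_mul_conj_of_bounded)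
open Summit.HodgeConjecture.HodgeConjecture.Cruxes.H413.K2E1ChiScalarRowsOfRecordU3 (amplitudeRows_of_unfolding)
open Summit.HodgeConjecture.HodgeConjecture.Cruxes.H413.K2E1ChiScalarRatioNonvanishingU3 (scalarRatio_one_ne_zero)
open Summit.HodgeConjecture.HodgeConjecture.Cruxes.H413.K2E1ChiScatteringCoordsEulerFactorisationKFiniteCMThree (exists_eulerFactorisation_of_tubeClause)
open Summit.HodgeConjecture.HodgeConjecture.Cruxes.H413.K2E1ChiTruncatedFamilyTransportCMThree (codiscrete_union)
open Summit.HodgeConjecture.HodgeConjecture.Cruxes.H413.K2E1ConvexDiffCountableConnected (isPreconnected_convex_diff_of_countable countable_of_codiscrete)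

namespace Summit.HodgeConjecture.HodgeConjecture.R90.S8

/-! ## §1 The Euler junction near `3∕2` -/

/-- **THE EULER JUNCTION NEAR `3∕2`** (generic): a continued scalar `qc` (analytic off the co-discrete `P`, `= q` on the tube, `q = A·cS` there with `A` holomorphic on `{1<Re}`,
`A(3∕2) ≠ 0`) and a continued coordinate `qcv` (analytic off the co-discrete `P′`, `= qv` on the tube, `qv = cS·a` there with `a` holomorphic on `{1<Re}`) satisfy
`qcv = qc·(a∕A)` on a punctured neighbourhood of `3∕2`: the identity theorem for `qcv·A` and `qc·a` on the CONNECTED `{1<Re} ∖ (P ∪ P′)` (★ `codiscrete_union`, ★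
`isPreconnected_convex_diff_of_countable`; base point in the tube off `P ∪ P′`), then `A ≠ 0` near `3∕2`. [cite: MoeglinWaldspurger1995, IV.1.11] [cite: Langlands1976, §6] -/
theorem eventuallyEq_coord_of_junction {qc q A cS qcv qv a : ℂ → ℂ} {P P' : Set ℂ}
    (hPcd : ∀ z₀ : ℂ, ∀ᶠ s in 𝓝[≠] z₀, s ∉ P) (hqa : ∀ z : ℂ, z ∉ P → AnalyticAt ℂ qc z) (hqcq : ∀ z : ℂ, 2 < z.re → qc z = q z)
    (hA : DifferentiableOn ℂ A {z : ℂ | 1 < z.re}) (hA32 : A (3 / 2) ≠ 0) (hq : ∀ z : ℂ, 2 < z.re → q z = A z * cS z)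
    (hP'cd : ∀ z₀ : ℂ, ∀ᶠ s in 𝓝[≠] z₀, s ∉ P') (hqcvP : ∀ z : ℂ, z ∉ P' → AnalyticAt ℂ qcv z) (hqcvq : ∀ z : ℂ, 2 < z.re → qcv z = qv z)
    (hqva : ∀ z : ℂ, 2 < z.re → qv z = cS z * a z) (ha : DifferentiableOn ℂ a {z : ℂ | 1 < z.re}) :
    ∀ᶠ z in 𝓝[≠] ((3 / 2 : ℂ)), qcv z = qc z * (a z / A z) := by
  have hO : IsOpen {z : ℂ | 1 < z.re} := isOpen_lt continuous_const Complex.continuous_re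
  have hO2 : IsOpen {z : ℂ | 2 < z.re} := isOpen_lt continuous_const Complex.continuous_re
  have hcd := codiscrete_union hPcd hP'cd
  -- the two products, analytic on the connected `D := {1<Re} ∖ (P ∪ P′)`
  have hDpc : IsPreconnected ({z : ℂ | 1 < z.re} \ (P ∪ P')) :=
    isPreconnected_convex_diff_of_countable Literature.Topology.Euclidean.one_lt_rank_real_complex (convex_halfSpace_re_gt (1 : ℝ)) hO (countable_of_codiscrete hcd)
  have hu : AnalyticOnNhd ℂ (fun z => qcv z * A z) ({z : ℂ | 1 < z.re} \ (P ∪ P')) :=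
    fun z hz => (hqcvP z fun h => hz.2 (Or.inr h)).mul (hA.analyticAt (hO.mem_nhds hz.1))
  have hv : AnalyticOnNhd ℂ (fun z => qc z * a z) ({z : ℂ | 1 < z.re} \ (P ∪ P')) :=
    fun z hz => (hqa z fun h => hz.2 (Or.inl h)).mul (ha.analyticAt (hO.mem_nhds hz.1))
  -- a base point in the tube off `P ∪ P′`, where the two products agree on a neighbourhood
  obtain ⟨z₁, hz₁P, hz₁⟩ := ((hcd 3).and (mem_nhdsWithin_of_mem_nhds (hO2.mem_nhds (show (3 : ℂ) ∈ {z : ℂ | 2 < z.re} by norm_num)))).exists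
  have hz₁' : 2 < z₁.re := hz₁
  have hz₁D : z₁ ∈ {z : ℂ | 1 < z.re} \ (P ∪ P') := ⟨lt_trans (by norm_num) hz₁', hz₁P⟩
  have heq : (fun z => qcv z * A z) =ᶠ[𝓝 z₁] fun z => qc z * a z := by
    filter_upwards [hO2.mem_nhds (show z₁ ∈ {z : ℂ | 2 < z.re} from hz₁')] with z hz
    have hz' : 2 < z.re := hz
    rw [hqcvq z hz', hqva z hz', hqcq z hz', hq z hz']
    ring
  have hEqOn := hu.eqOn_of_preconnected_of_eventuallyEq hv hDpc hz₁D heq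
  -- near `3∕2`: inside `D`, and `A ≠ 0`
  have h32 : (3 / 2 : ℂ) ∈ {z : ℂ | 1 < z.re} := by
    show (1 : ℝ) < ((3 : ℂ) / 2).re
    norm_num
  have hAne : ∀ᶠ z in 𝓝 ((3 / 2 : ℂ)), A z ≠ 0 := (hA.continuousOn.continuousAt (hO.mem_nhds h32)).eventually_ne hA32
  filter_upwards [mem_nhdsWithin_of_mem_nhds (hO.mem_nhds h32), hcd _, mem_nhdsWithin_of_mem_nhds hAne] with z hz hzP hAz
  have h : qcv z * A z = qc z * a z := hEqOn ⟨hz, hzP⟩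
  rw [← mul_div_assoc, eq_div_iff hAz, h]

/-! ## §2 HEAD: (R)′τ OF RECORD, second edition -/

variable (L : Type) [Field L] [NumberField L] [IsCMField L] [MeasurableSpace (quasiSplit (↥(maximalRealSubfield L)) L (IsCMField.complexConj L) 3).Adelic] [BorelSpace (quasiSplit (↥(maximalRealSubfield L)) L (IsCMField.complexConj L) 3).Adelic]

/-- **(R)′τ OF RECORD, SECOND EDITION — `resGMidBlockτ ξ μω ≤ L²_res(𝔓)`** at the socket frame of B ED. 7 :337, the rows bound BY NAME where ★ (see the module docstring for the
letter list and the one row that is not closed tonight).  PROOF: scalar residue ★ F5 + removable `d₀` ★ (once); a normalised Heisenberg package ★; the τ-SPINE (★ `resGMidBlockτ_le`,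
closure minimality into `L²_disc ⊓ (L²_cusp)ᗮ`, disc by ★ `hdisc_of_admissible`); per τ-generator: `hCONT` ★ of `hTEXP6`, `hEXP` ★ of `hCO`, the profile rows ★ of `hUNF`, the columns
`hCOLS`, the factorisation ★ p864880 of `hunfK`, the junction §1, hSCAT's package ★ `exists_hSCAT_of_factorisation` on the quarter planes (off-axis exclusion `hPreal`; Gram ★; `hreal`),
then ed. 1's road ∕ SCAL ∕ CT ∕ operator chain verbatim, the tube seed ★ and the inner product ★.
[cite: MoeglinWaldspurger1995, I.2.18, IV.1.9–IV.1.11, IV.2.3, V.3.13] [cite: Rogawski1990, §13.9 p. 229 (ii)] [cite: Langlands1976, §6–§7] [cite: BernsteinLapid2019, §4, §7] -/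
theorem resGMidBlockτ_le_residual_of_record_v2 [MeasurableSpace (AdeleRing (𝓞 L) L)ˣ] [BorelSpace (AdeleRing (𝓞 L) L)ˣ]
    [MeasurableSpace ↥(arch (↥(maximalRealSubfield L)) L (IsCMField.complexConj L) 3 ((StdForm.antidiagonal 3).over L))] [BorelSpace ↥(arch (↥(maximalRealSubfield L)) L (IsCMField.complexConj L) 3 ((StdForm.antidiagonal 3).over L))] [MeasurableSpace ↥(finAdelic (↥(maximalRealSubfield L)) L (IsCMField.complexConj L) 3 ((StdForm.antidiagonal 3).over L))] [BorelSpace ↥(finAdelic (↥(maximalRealSubfield L)) L (IsCMField.complexConj L) 3 ((StdForm.antidiagonal 3).over L))]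
    (μ : Measure (quasiSplit (↥(maximalRealSubfield L)) L (IsCMField.complexConj L) 3).automorphicQuotient) [(quasiSplit (↥(maximalRealSubfield L)) L (IsCMField.complexConj L) 3).IsAutomorphicMeasure μ]
    (𝔓 : (quasiSplit (↥(maximalRealSubfield L)) L (IsCMField.complexConj L) 3).ParabolicUnipotentData) (h𝔓 : ∀ j : 𝔓.ι, 𝔓.radical j = adelicUnipotent (↥(maximalRealSubfield L)) L (IsCMField.complexConj L) 3) (hne : Nonempty 𝔓.ι)
    (μω : HeckeCharacter L) (hμu : μω.IsUnitary) (hquad : (∀ x : Literature.NumberTheory.GaloisRepresentations.ideleGroup ↥(maximalRealSubfield L), μω (AdeleRing.ideleBaseChange (↥(maximalRealSubfield L)) L x) = quadraticHeckeCharCM L x)) (ξ : OneDimAutRepH L)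
    -- L1 at the frame (as ed. 1)
    -- L1 at the frame
    (hDISC : ∀ (E : Submodule ℂ (resGMidBlock L μ ξ μω).toSubmodule)
          (hE : ∀ k, ∀ x ∈ E, ((resGMidBlock L μ ξ μω).toContRep.restrict (((standardMaximalCompactGL 3 L).comap (adelicVal (↥(maximalRealSubfield L)) L (IsCMField.complexConj L) 3 ((StdForm.antidiagonal 3).over L)) : Subgroup (quasiSplit (↥(maximalRealSubfield L)) L (IsCMField.complexConj L) 3).Adelic)).subtype) k x ∈ E), FiniteDimensional ℂ E →
          (((resGMidBlock L μ ξ μω).toContRep.restrict (((standardMaximalCompactGL 3 L).comap (adelicVal (↥(maximalRealSubfield L)) L (IsCMField.complexConj L) 3 ((StdForm.antidiagonal 3).over L)) : Subgroup (quasiSplit (↥(maximalRealSubfield L)) L (IsCMField.complexConj L) 3).Adelic)).subtype).subRep E hE).IsIrreducible →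
          FiniteDimensional ℂ (Representation.homRangeSum ((resGMidBlock L μ ξ μω).toContRep.restrict (((standardMaximalCompactGL 3 L).comap (adelicVal (↥(maximalRealSubfield L)) L (IsCMField.complexConj L) 3 ((StdForm.antidiagonal 3).over L)) : Subgroup (quasiSplit (↥(maximalRealSubfield L)) L (IsCMField.complexConj L) 3).Adelic)).subtype).toRepresentation (((resGMidBlock L μ ξ μω).toContRep.restrict (((standardMaximalCompactGL 3 L).comap (adelicVal (↥(maximalRealSubfield L)) L (IsCMField.complexConj L) 3 ((StdForm.antidiagonal 3).over L)) : Subgroup (quasiSplit (↥(maximalRealSubfield L)) L (IsCMField.complexConj L) 3).Adelic)).subtype).subRep E hE)))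
    -- the EXPORTS FRAME and the PORTS' HAAR FRAME of ★ `hEXP_tauRow_closed'` (its own Heisenberg package `νE, 𝓕E`; auxiliary `μa μf`)
    (νG : Measure (quasiSplit (↥(maximalRealSubfield L)) L (IsCMField.complexConj L) 3).Adelic) [νG.IsHaarMeasure] [νG.IsInvInvariant] [SFinite νG]
    (νE : Measure ↥(adelicUnipotent (↥(maximalRealSubfield L)) L (IsCMField.complexConj L) 3)) [νE.IsHaarMeasure] [νE.IsMulRightInvariant] [νE.IsInvInvariant]
    {𝓕E : Set ↥(adelicUnipotent (↥(maximalRealSubfield L)) L (IsCMField.complexConj L) 3)}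
    (h𝓕EN : IsFundamentalDomain ↥(rationalUnipotent (↥(maximalRealSubfield L)) L (IsCMField.complexConj L) 3) 𝓕E νE) (h𝓕Ec : IsCompact (closure 𝓕E)) (h𝓕E0 : νE 𝓕E ≠ 0)
    {β : (quasiSplit (↥(maximalRealSubfield L)) L (IsCMField.complexConj L) 3).Adelic → ℝ≥0∞}
    (hβ : IsCoveringWeight ↥((arithmeticBorel (↥(maximalRealSubfield L)) L (IsCMField.complexConj L) 3).map (quasiSplit (↥(maximalRealSubfield L)) L (IsCMField.complexConj L) 3).arithmeticSubgroup.subtype) β)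
    {μZ : Measure (borelQuotient (↥(maximalRealSubfield L)) L (IsCMField.complexConj L) 3)} [SFinite μZ]
    (hμZ : ∀ f : borelQuotient (↥(maximalRealSubfield L)) L (IsCMField.complexConj L) 3 → ℝ≥0∞, Measurable f → ∫⁻ z, f z ∂μZ = ∫⁻ g, β g * f (toBorelQuotient (↥(maximalRealSubfield L)) L (IsCMField.complexConj L) 3 g) ∂νG)
    (μa : Measure ↥(arch (↥(maximalRealSubfield L)) L (IsCMField.complexConj L) 3 ((StdForm.antidiagonal 3).over L))) [μa.IsHaarMeasure] [μa.IsMulRightInvariant]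
    (μf : Measure ↥(finAdelic (↥(maximalRealSubfield L)) L (IsCMField.complexConj L) 3 ((StdForm.antidiagonal 3).over L))) [μf.IsHaarMeasure]
    -- (L′) the restricted CO-WEIGHT LINE letter of ★ p864795 (pays the `hEXP` τ-row)
    (hCO : ∀ (W₀ : Submodule ℂ ((quasiSplit (↥(maximalRealSubfield L)) L (IsCMField.complexConj L) 3).Adelic → ℂ)) (hW₀K : ∀ k : ↥(archMaximalCompact L), ∀ ψ ∈ W₀, ((rightTranslation (quasiSplit (↥(maximalRealSubfield L)) L (IsCMField.complexConj L) 3)).comp (archMaximalCompact L).subtype) k ψ ∈ W₀) (_ : FiniteDimensional ℂ ↥W₀)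
      (_ : ∀ ψ ∈ W₀, IsChiSectionPair (ξ.bcη⁻¹ * ξ.bcψ⁻¹ * μω) ξ.ψ ψ) (_ : ∀ ψ ∈ W₀, Continuous ψ) (_ : (Subrepresentation.toRepresentation (⟨W₀, hW₀K⟩ : Subrepresentation ((rightTranslation (quasiSplit (↥(maximalRealSubfield L)) L (IsCMField.complexConj L) 3)).comp (archMaximalCompact L).subtype))).IsIrreducible),
      ∃ l₀ : ↥W₀ →ₗ[ℂ] ℂ, ∀ l : ↥W₀ →ₗ[ℂ] ℂ,
        (∀ (m : ↥(arch (↥(maximalRealSubfield L)) L (IsCMField.complexConj L) 3 ((StdForm.antidiagonal 3).over L))) (hmB : (archToAdelic (↥(maximalRealSubfield L)) L (IsCMField.complexConj L) 3 ((StdForm.antidiagonal 3).over L)) m ∈ borelAdelic (↥(maximalRealSubfield L)) L (IsCMField.complexConj L) 3) (hmK : (adelicVal (↥(maximalRealSubfield L)) L (IsCMField.complexConj L) 3 ((StdForm.antidiagonal 3).over L)) ((archToAdelic (↥(maximalRealSubfield L)) L (IsCMField.complexConj L) 3 ((StdForm.antidiagonal 3).over L)) m) ∈ standardMaximalCompactGL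 3 L) (w : ↥W₀),
          l ((Subrepresentation.toRepresentation (⟨W₀, hW₀K⟩ : Subrepresentation ((rightTranslation (quasiSplit (↥(maximalRealSubfield L)) L (IsCMField.complexConj L) 3)).comp (archMaximalCompact L).subtype))) ⟨(archToAdelic (↥(maximalRealSubfield L)) L (IsCMField.complexConj L) 3 ((StdForm.antidiagonal 3).over L)) m, archToAdelic_mem_archMaximalCompact L m hmK⟩ w) = ((((ξ.bcη⁻¹ * ξ.bcψ⁻¹ * μω)) (firstEntryUnit hmB) : ℂˣ) : ℂ) * (((ξ.ψ) (middleEntryUnitary hmB) : ℂˣ) : ℂ) * l w) →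
        ∃ a : ℂ, l = a • l₀)
    -- the EXPORTS-WITH-(E6) τ-row (pays the `hCONT` τ-row through ★ p864638; see the module docstring for why it is not closed from `hCO` tonight)
    (hTEXP6 : ∀ (U₀ : Subgroup ↥(finAdelic (↥(maximalRealSubfield L)) L (IsCMField.complexConj L) 3 ((StdForm.antidiagonal 3).over L))) (_ : IsTauLevel L U₀)
      (φ : (quasiSplit (↥(maximalRealSubfield L)) L (IsCMField.complexConj L) 3).Adelic → ℂ) (_ : φ ∈ chiSectionSpacePair (ξ.bcη⁻¹ * ξ.bcψ⁻¹ * μω) ξ.ψ (tauLevel L U₀) ((1 : ↥(tauLevel L U₀) →* ℂ) : ↥(tauLevel L U₀) → ℂ)) (_ : Continuous φ)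
      (_ : IsArchFinite L φ)
      (ν : Measure ↥(adelicUnipotent (↥(maximalRealSubfield L)) L (IsCMField.complexConj L) 3)) (_ : ν.IsHaarMeasure) (𝓕 : Set ↥(adelicUnipotent (↥(maximalRealSubfield L)) L (IsCMField.complexConj L) 3))
      (_ : IsFundamentalDomain ↥(rationalUnipotent (↥(maximalRealSubfield L)) L (IsCMField.complexConj L) 3) 𝓕 ν) (_ : IsCompact (closure 𝓕)) (_ : ν.IsInvInvariant) (_ : ν 𝓕 = 1),
      ∃ (Ec' : ℂ → (quasiSplit (↥(maximalRealSubfield L)) L (IsCMField.complexConj L) 3).Adelic → ℂ) (P : Set ℂ), IsClosed P ∧ (∀ z₀ : ℂ, ∀ᶠ s in 𝓝[≠] z₀, s ∉ P) ∧ (∀ z ∈ P, z.re ≤ 2) ∧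
        (∀ z : ℂ, 2 < z.re → Ec' z = eisensteinSeriesU (flatSectionU φ z)) ∧ (∀ g (z : ℂ), z ∉ P → AnalyticAt ℂ (fun z => Ec' z g) z) ∧
        (∀ z : ℂ, z ∉ P → Continuous (Ec' z)) ∧
        (∀ z₁ : ℂ, z₁ ∉ P → ∀ K : Set (quasiSplit (↥(maximalRealSubfield L)) L (IsCMField.complexConj L) 3).Adelic, IsCompact K → ∃ V ∈ 𝓝 z₁, ∃ M : ℝ, ∀ z ∈ V, ∀ g ∈ K, ‖Ec' z g‖ ≤ M) ∧
        (∀ T : ℝ≥0, 1 ≤ T → ∃ Fam : ℂ → Lp ℂ 2 μ, DifferentiableOn ℂ Fam Pᶜ ∧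
          ∀ z : ℂ, z ∉ P → ((Fam z : Lp ℂ 2 μ) : (quasiSplit (↥(maximalRealSubfield L)) L (IsCMField.complexConj L) 3).automorphicQuotient → ℂ) =ᵐ[μ] (quasiSplit (↥(maximalRealSubfield L)) L (IsCMField.complexConj L) 3).quotFun (truncation ν 𝓕 T (Ec' z))))
    -- (V) (iii): the F5 scalar rows at `φ := ξ.bcη⁻¹ * μω`, `η := 1`, ONCE
    {S : Set (HeightOneSpectrum (𝓞 L))} {T' : Set (HeightOneSpectrum (𝓞 ↥(maximalRealSubfield L)))}
    (hS : S.Finite) (hurφ : ∀ w ∉ S, (ξ.bcη⁻¹ * μω).IsUnramifiedAt w) (hT' : T'.Finite) (hurη : ∀ v ∉ T', (1 : HeckeCharacter ↥(maximalRealSubfield L)).IsUnramifiedAt v)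
    (q qc : ℂ → ℂ) {P : Set ℂ} (hqcq : ∀ z : ℂ, 2 < z.re → qc z = q z) (hPcd : ∀ z₀ : ℂ, ∀ᶠ s in 𝓝[≠] z₀, s ∉ P) (hqa : ∀ z : ℂ, z ∉ P → AnalyticAt ℂ qc z)
    (A : ℂ → ℂ) (hA : DifferentiableOn ℂ A {z : ℂ | 1 < z.re})
    (hsrc : ∀ z : ℂ, 2 < z.re → q z = A z *
          ((partialStandardL S (fun w => {(ξ.bcη⁻¹ * μω).valueAtUniformizer w}) (z - 1) * partialStandardL T' (fun v => {(1 : HeckeCharacter ↥(maximalRealSubfield L)).valueAtUniformizer v}) (2 * z - 2)) /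
            (partialStandardL S (fun w => {(ξ.bcη⁻¹ * μω).valueAtUniformizer w}) z * partialStandardL T' (fun v => {(1 : HeckeCharacter ↥(maximalRealSubfield L)).valueAtUniformizer v}) (2 * z - 1))))
    (hA32 : A (3 / 2) ≠ 0)
    -- PER τ-GENERATOR: the UNFOLDING letter (pays `hSCALrows` through ★ `amplitudeRows_of_unfolding` at the scalar of record)
    (hUNF :
      ∀ (U₀ : Subgroup ↥(finAdelic (↥(maximalRealSubfield L)) L (IsCMField.complexConj L) 3 ((StdForm.antidiagonal 3).over L))) (_ : IsTauLevel L U₀)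
      (φ : (quasiSplit (↥(maximalRealSubfield L)) L (IsCMField.complexConj L) 3).Adelic → ℂ) (_ : φ ∈ chiSectionSpacePair (ξ.bcη⁻¹ * ξ.bcψ⁻¹ * μω) ξ.ψ (tauLevel L U₀) ((1 : ↥(tauLevel L U₀) →* ℂ) : ↥(tauLevel L U₀) → ℂ)) (_ : Continuous φ)
      (_ : IsArchFinite L φ)
      (Ec : ℂ → (quasiSplit (↥(maximalRealSubfield L)) L (IsCMField.complexConj L) 3).Adelic → ℂ) (Sp : Finset ℂ) (_ : ∀ s ∈ Sp, s.im = 0 ∧ 1 < s.re ∧ s.re ≤ 2)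
      (_ : ∀ g, DifferentiableOn ℂ (fun z => Ec z g) ({z : ℂ | 1 < z.re} \ (↑Sp : Set ℂ)))
      (_ : ∀ z : ℂ, 2 < z.re → Ec z = eisensteinSeriesU (flatSectionU φ z))
      (Fp : (quasiSplit (↥(maximalRealSubfield L)) L (IsCMField.complexConj L) 3).Adelic → ℂ → ℂ) (_ : ∀ g, AnalyticAt ℂ (Fp g) ((3 : ℂ) / 2))
      (_ : ∀ g, Fp g =ᶠ[𝓝[≠] ((3 : ℂ) / 2)] fun z => (z - (3 : ℂ) / 2) * Ec z g)
      (f : (quasiSplit (↥(maximalRealSubfield L)) L (IsCMField.complexConj L) 3).L2 μ) (_ : (f : (quasiSplit (↥(maximalRealSubfield L)) L (IsCMField.complexConj L) 3).automorphicQuotient → ℂ) =ᵐ[μ] fun x => Fp (Quotient.out (x : (quasiSplit (↥(maximalRealSubfield L)) L (IsCMField.complexConj L) 3).Adelic ⧸ (quasiSplit (↥(maximalRealSubfield L)) L (IsCMField.complexConj L) 3).quotientSubgroup))⁻¹ ((3 : ℂ) / 2))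
      (ν : Measure ↥(adelicUnipotent (↥(maximalRealSubfield L)) L (IsCMField.complexConj L) 3)) (_ : ν.IsHaarMeasure) (𝓕 : Set ↥(adelicUnipotent (↥(maximalRealSubfield L)) L (IsCMField.complexConj L) 3)) (_ : IsFundamentalDomain ↥(rationalUnipotent (↥(maximalRealSubfield L)) L (IsCMField.complexConj L) 3) 𝓕 ν) (_ : IsCompact (closure 𝓕)) (_ : ν.IsInvInvariant) (_ : ν 𝓕 = 1),
      ∃ (Ag : (quasiSplit (↥(maximalRealSubfield L)) L (IsCMField.complexConj L) 3).Adelic → ℂ → ℂ) (M : ℝ),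
        (∀ g, DifferentiableOn ℂ (Ag g) {z : ℂ | 1 < z.re}) ∧ (∀ g, ‖Ag g (3 / 2)‖ ≤ M) ∧
        (∀ z : ℂ, 2 < z.re → ∀ g : (quasiSplit (↥(maximalRealSubfield L)) L (IsCMField.complexConj L) 3).Adelic, (borelConstantTerm ν 𝓕 (Ec z) g - φ g * (((borelHeight g : ℝ≥0) : ℝ) : ℂ) ^ z) / (((borelHeight g : ℝ≥0) : ℝ) : ℂ) ^ (2 - z) = Ag g z *
          ((partialStandardL S (fun w => {(ξ.bcη⁻¹ * μω).valueAtUniformizer w}) (z - 1) * partialStandardL T' (fun v => {(1 : HeckeCharacter ↥(maximalRealSubfield L)).valueAtUniformizer v}) (2 * z - 2)) /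
            (partialStandardL S (fun w => {(ξ.bcη⁻¹ * μω).valueAtUniformizer w}) z * partialStandardL T' (fun v => {(1 : HeckeCharacter ↥(maximalRealSubfield L)).valueAtUniformizer v}) (2 * z - 1)))))
    -- PER τ-GENERATOR: the export tuple WITH COLUMNS (un-projected K-finite exports; ED. 2 removes it by index concatenation over pure pieces)
    (hCOLS :
      ∀ (U₀ : Subgroup ↥(finAdelic (↥(maximalRealSubfield L)) L (IsCMField.complexConj L) 3 ((StdForm.antidiagonal 3).over L))) (_ : IsTauLevel L U₀)
      (φ : (quasiSplit (↥(maximalRealSubfield L)) L (IsCMField.complexConj L) 3).Adelic → ℂ) (_ : φ ∈ chiSectionSpacePair (ξ.bcη⁻¹ * ξ.bcψ⁻¹ * μω) ξ.ψ (tauLevel L U₀) ((1 : ↥(tauLevel L U₀) →* ℂ) : ↥(tauLevel L U₀) → ℂ)) (_ : Continuous φ)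
      (_ : IsArchFinite L φ)
      (ν : Measure ↥(adelicUnipotent (↥(maximalRealSubfield L)) L (IsCMField.complexConj L) 3)) (_ : ν.IsHaarMeasure) (𝓕 : Set ↥(adelicUnipotent (↥(maximalRealSubfield L)) L (IsCMField.complexConj L) 3)) (_ : IsFundamentalDomain ↥(rationalUnipotent (↥(maximalRealSubfield L)) L (IsCMField.complexConj L) 3) 𝓕 ν) (_ : IsCompact (closure 𝓕)) (_ : ν.IsInvInvariant) (_ : ν 𝓕 = 1),
      ∃ (ι : Type) (_ : Fintype ι) (φ' : ι → (quasiSplit (↥(maximalRealSubfield L)) L (IsCMField.complexConj L) 3).Adelic → ℂ) (qv qcv : ι → ℂ → ℂ) (Pv : Set ℂ),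
        LinearIndependent ℂ φ' ∧
        (∀ j, IsChiSectionPair (reflectChar (IsCMField.complexConj L) (ξ.bcη⁻¹ * ξ.bcψ⁻¹ * μω)) ξ.ψ (φ' j)) ∧
        (∀ j, Continuous (φ' j)) ∧
        (∀ j, ∃ C : ℝ, ∀ x, ‖φ' j x‖ ≤ C) ∧
        (∀ z : ℂ, 2 < z.re → (∑ j, qv j z • φ' j) = ((((ν 𝓕).toReal⁻¹ : ℝ)) : ℂ) • (fun g : (quasiSplit (↥(maximalRealSubfield L)) L (IsCMField.complexConj L) 3).Adelic => (∫ v : ↥(adelicUnipotent (↥(maximalRealSubfield L)) L (IsCMField.complexConj L) 3), flatSectionU φ z ((quasiSplit (↥(maximalRealSubfield L)) L (IsCMField.complexConj L) 3).toAdelic (weylLongU ((IsCMField.complexConj L : L ≃ₐ[↥(maximalRealSubfield L)] L) : L →+* L) (rfl : (StdForm.antidiagonal 3).over L = (StdForm.antidiagonal 3).over L)) * ((v : (quasiSplit (↥(maximalRealSubfield L)) L (IsCMField.complexConj L) 3).Adelic) * g)) ∂ν) * (((borelHeight g : ℝ) : ℂ) ^ (z - 2)))) ∧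
        (∀ z₀ : ℂ, ∀ᶠ s in 𝓝[≠] z₀, s ∉ Pv) ∧
        (∀ z ∈ Pv, z.re ≤ 2) ∧
        (∀ j (z : ℂ), z ∉ Pv → AnalyticAt ℂ (qcv j) z) ∧
        (∀ j (z : ℂ), 2 < z.re → qcv j z = qv j z))
    -- PER τ-GENERATOR: the per-base-point Euler factorisation on `K_max` AT THE SCALAR OF RECORD (★ p864880's `hunfK`, `cS :=` ★ F5's ratio)
    (hunfK :
      ∀ (U₀ : Subgroup ↥(finAdelic (↥(maximalRealSubfield L)) L (IsCMField.complexConj L) 3 ((StdForm.antidiagonal 3).over L))) (_ : IsTauLevel L U₀)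
      (φ : (quasiSplit (↥(maximalRealSubfield L)) L (IsCMField.complexConj L) 3).Adelic → ℂ) (_ : φ ∈ chiSectionSpacePair (ξ.bcη⁻¹ * ξ.bcψ⁻¹ * μω) ξ.ψ (tauLevel L U₀) ((1 : ↥(tauLevel L U₀) →* ℂ) : ↥(tauLevel L U₀) → ℂ)) (_ : Continuous φ)
      (_ : IsArchFinite L φ)
      (ν : Measure ↥(adelicUnipotent (↥(maximalRealSubfield L)) L (IsCMField.complexConj L) 3)) (_ : ν.IsHaarMeasure) (𝓕 : Set ↥(adelicUnipotent (↥(maximalRealSubfield L)) L (IsCMField.complexConj L) 3)) (_ : IsFundamentalDomain ↥(rationalUnipotent (↥(maximalRealSubfield L)) L (IsCMField.complexConj L) 3) 𝓕 ν) (_ : IsCompact (closure 𝓕)) (_ : ν.IsInvInvariant) (_ : ν 𝓕 = 1),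
      ∀ k : (quasiSplit (↥(maximalRealSubfield L)) L (IsCMField.complexConj L) 3).Adelic, adelicVal (↥(maximalRealSubfield L)) L (IsCMField.complexConj L) 3 ((StdForm.antidiagonal 3).over L) k ∈ standardMaximalCompactGL 3 L →
        ∃ A' : ℂ → ℂ, DifferentiableOn ℂ A' {z : ℂ | 1 < z.re} ∧ ∀ z : ℂ, 2 < z.re →
          (∫ v : ↥(adelicUnipotent (↥(maximalRealSubfield L)) L (IsCMField.complexConj L) 3), flatSectionU φ z ((quasiSplit (↥(maximalRealSubfield L)) L (IsCMField.complexConj L) 3).toAdelic (weylLongU ((IsCMField.complexConj L : L ≃ₐ[↥(maximalRealSubfield L)] L) : L →+* L) (rfl : (StdForm.antidiagonal 3).over L = (StdForm.antidiagonal 3).over L)) * ((v : (quasiSplit (↥(maximalRealSubfield L)) L (IsCMField.complexConj L) 3).Adelic) * k)) ∂ν) =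
            ((partialStandardL S (fun w => {(ξ.bcη⁻¹ * μω).valueAtUniformizer w}) (z - 1) * partialStandardL T' (fun v => {(1 : HeckeCharacter ↥(maximalRealSubfield L)).valueAtUniformizer v}) (2 * z - 2)) / (partialStandardL S (fun w => {(ξ.bcη⁻¹ * μω).valueAtUniformizer w}) z * partialStandardL T' (fun v => {(1 : HeckeCharacter ↥(maximalRealSubfield L)).valueAtUniformizer v}) (2 * z - 1))) * A' z)
    -- PER τ-GENERATOR: OFF-AXIS POLE EXCLUSION of the continued coordinates in the half-plane `{1 < Re}` [MW95 IV.1.11]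
    (hPreal :
      ∀ (U₀ : Subgroup ↥(finAdelic (↥(maximalRealSubfield L)) L (IsCMField.complexConj L) 3 ((StdForm.antidiagonal 3).over L))) (_ : IsTauLevel L U₀)
      (φ : (quasiSplit (↥(maximalRealSubfield L)) L (IsCMField.complexConj L) 3).Adelic → ℂ) (_ : φ ∈ chiSectionSpacePair (ξ.bcη⁻¹ * ξ.bcψ⁻¹ * μω) ξ.ψ (tauLevel L U₀) ((1 : ↥(tauLevel L U₀) →* ℂ) : ↥(tauLevel L U₀) → ℂ)) (_ : Continuous φ)
      (_ : IsArchFinite L φ)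
      (ν : Measure ↥(adelicUnipotent (↥(maximalRealSubfield L)) L (IsCMField.complexConj L) 3)) (_ : ν.IsHaarMeasure) (𝓕 : Set ↥(adelicUnipotent (↥(maximalRealSubfield L)) L (IsCMField.complexConj L) 3)) (_ : IsFundamentalDomain ↥(rationalUnipotent (↥(maximalRealSubfield L)) L (IsCMField.complexConj L) 3) 𝓕 ν) (_ : IsCompact (closure 𝓕)) (_ : ν.IsInvInvariant) (_ : ν 𝓕 = 1),
      ∀ (ι : Type) [Fintype ι] (φ' : ι → (quasiSplit (↥(maximalRealSubfield L)) L (IsCMField.complexConj L) 3).Adelic → ℂ) (qv qcv : ι → ℂ → ℂ) (Pv : Set ℂ),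
        LinearIndependent ℂ φ' →
        (∀ j, IsChiSectionPair (reflectChar (IsCMField.complexConj L) (ξ.bcη⁻¹ * ξ.bcψ⁻¹ * μω)) ξ.ψ (φ' j)) →
        (∀ j, Continuous (φ' j)) →
        (∀ j, ∃ C : ℝ, ∀ x, ‖φ' j x‖ ≤ C) →
        (∀ z : ℂ, 2 < z.re → (∑ j, qv j z • φ' j) = ((((ν 𝓕).toReal⁻¹ : ℝ)) : ℂ) • (fun g : (quasiSplit (↥(maximalRealSubfield L)) L (IsCMField.complexConj L) 3).Adelic => (∫ v : ↥(adelicUnipotent (↥(maximalRealSubfield L)) L (IsCMField.complexConj L) 3), flatSectionU φ z ((quasiSplit (↥(maximalRealSubfield L)) L (IsCMField.complexConj L) 3).toAdelic (weylLongU ((IsCMField.complexConj L : L ≃ₐ[↥(maximalRealSubfield L)] L) : L →+* L) (rfl : (StdForm.antidiagonal 3).over L = (StdForm.antidiagonal 3).over L)) * ((v : (quasiSplit (↥(maximalRealSubfield L)) L (IsCMField.complexConj L) 3).Adelic) * g)) ∂ν) * (((borelHeight g : ℝ) : ℂ) ^ (z - 2)))) →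
        (∀ z₀ : ℂ, ∀ᶠ s in 𝓝[≠] z₀, s ∉ Pv) →
        (∀ z ∈ Pv, z.re ≤ 2) →
        (∀ j (z : ℂ), z ∉ Pv → AnalyticAt ℂ (qcv j) z) →
        (∀ j (z : ℂ), 2 < z.re → qcv j z = qv j z) →
      ∀ j (z : ℂ), 1 < z.re → z.im ≠ 0 → AnalyticAt ℂ (qcv j) z)
    -- PER τ-GENERATOR: AXIS REALITY of the closed-formula `wc` near `3∕2` (self-associate bracket) [MW95 IV.1.10]
    (hreal :
      ∀ (U₀ : Subgroup ↥(finAdelic (↥(maximalRealSubfield L)) L (IsCMField.complexConj L) 3 ((StdForm.antidiagonal 3).over L))) (_ : IsTauLevel L U₀)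
      (φ : (quasiSplit (↥(maximalRealSubfield L)) L (IsCMField.complexConj L) 3).Adelic → ℂ) (_ : φ ∈ chiSectionSpacePair (ξ.bcη⁻¹ * ξ.bcψ⁻¹ * μω) ξ.ψ (tauLevel L U₀) ((1 : ↥(tauLevel L U₀) →* ℂ) : ↥(tauLevel L U₀) → ℂ)) (_ : Continuous φ)
      (_ : IsArchFinite L φ)
      (ν : Measure ↥(adelicUnipotent (↥(maximalRealSubfield L)) L (IsCMField.complexConj L) 3)) (_ : ν.IsHaarMeasure) (𝓕 : Set ↥(adelicUnipotent (↥(maximalRealSubfield L)) L (IsCMField.complexConj L) 3)) (_ : IsFundamentalDomain ↥(rationalUnipotent (↥(maximalRealSubfield L)) L (IsCMField.complexConj L) 3) 𝓕 ν) (_ : IsCompact (closure 𝓕)) (_ : ν.IsInvInvariant) (_ : ν 𝓕 = 1),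
      ∀ (ι : Type) [Fintype ι] (φ' : ι → (quasiSplit (↥(maximalRealSubfield L)) L (IsCMField.complexConj L) 3).Adelic → ℂ) (qv qcv : ι → ℂ → ℂ) (Pv : Set ℂ),
        LinearIndependent ℂ φ' →
        (∀ j, IsChiSectionPair (reflectChar (IsCMField.complexConj L) (ξ.bcη⁻¹ * ξ.bcψ⁻¹ * μω)) ξ.ψ (φ' j)) →
        (∀ j, Continuous (φ' j)) →
        (∀ j, ∃ C : ℝ, ∀ x, ‖φ' j x‖ ≤ C) →
        (∀ z : ℂ, 2 < z.re → (∑ j, qv j z • φ' j) = ((((ν 𝓕).toReal⁻¹ : ℝ)) : ℂ) • (fun g : (quasiSplit (↥(maximalRealSubfield L)) L (IsCMField.complexConj L) 3).Adelic => (∫ v : ↥(adelicUnipotent (↥(maximalRealSubfield L)) L (IsCMField.complexConj L) 3), flatSectionU φ z ((quasiSplit (↥(maximalRealSubfield L)) L (IsCMField.complexConj L) 3).toAdelic (weylLongU ((IsCMField.complexConj L : L ≃ₐ[↥(maximalRealSubfield L)] L) : L →+* L) (rfl : (StdForm.antidiagonal 3).over L = (StdForm.antidiagonal 3).over L)) *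 ((v : (quasiSplit (↥(maximalRealSubfield L)) L (IsCMField.complexConj L) 3).Adelic) * g)) ∂ν) * (((borelHeight g : ℝ) : ℂ) ^ (z - 2)))) →
        (∀ z₀ : ℂ, ∀ᶠ s in 𝓝[≠] z₀, s ∉ Pv) →
        (∀ z ∈ Pv, z.re ≤ 2) →
        (∀ j (z : ℂ), z ∉ Pv → AnalyticAt ℂ (qcv j) z) →
        (∀ j (z : ℂ), 2 < z.re → qcv j z = qv j z) →
      (∀ (μK : Measure ↥((standardMaximalCompactGL 3 L).comap (adelicVal (↥(maximalRealSubfield L)) L (IsCMField.complexConj L) 3 ((StdForm.antidiagonal 3).over L)) : Subgroup (quasiSplit (↥(maximalRealSubfield L)) L (IsCMField.complexConj L) 3).Adelic)) (_ : μK.IsHaarMeasure) (νI : Measure (AdeleRing (𝓞 L) L)ˣ) (_ : νI.IsHaarMeasure) (𝓕I : Set (AdeleRing (𝓞 L) L)ˣ) (_ : IsIdeleClassDomain L 𝓕I) (wc : ℂ → ℂ),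
          (∀ z : ℂ, wc z = (∑ j, qcv j z * ∫ k, φ' j (k : (quasiSplit (↥(maximalRealSubfield L)) L (IsCMField.complexConj L) 3).Adelic) * conj (φ (k : (quasiSplit (↥(maximalRealSubfield L)) L (IsCMField.complexConj L) 3).Adelic)) ∂μK) * ∫ x in {x : (AdeleRing (𝓞 L) L)ˣ | (IdeleClassGroup.ideleNorm L x : ℝ) ≤ 1} ∩ 𝓕I, ((IdeleClassGroup.ideleNorm L x : ℝ) : ℂ) * (((reflectChar (IsCMField.complexConj L) (ξ.bcη⁻¹ * ξ.bcψ⁻¹ * μω) x : ℂˣ) : ℂ) * conj (((ξ.bcη⁻¹ * ξ.bcψ⁻¹ * μω) x : ℂˣ) : ℂ)) ∂νI) → ∀ᶠ x : ℝ in 𝓝[≠] (3 / 2 : ℝ), (wc (x : ℂ)).im = 0)) :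
    resGMidBlockτ L μ ξ μω ≤ residualSubspace (quasiSplit (↥(maximalRealSubfield L)) L (IsCMField.complexConj L) 3) μ 𝔓 := by
  -- the scalar residue `ρ` (★ F5) and the removable singularity `d₀ = (z − 3∕2)·qc`, once (ed. 1)
  obtain ⟨ρ, hρ, -⟩ := exists_residue_at_threeHalves_cm_three L (isUnitary_bcηInv_mul L ξ hμu) (bcηInv_mul_posRealIdele L ξ μω hquad) hS hurφ
    (heckeChar_one_isUnitary ↥(maximalRealSubfield L)) (heckeChar_one_posRealIdele ↥(maximalRealSubfield L)) hT' hurη q qc hqcq hPcd hqa A hA hsrc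
  obtain ⟨d₀, hd₀, hd₀q, -⟩ := exists_analyticAt_eventuallyEq_mul_sub_of_tendsto (eventually_nhdsWithin_iff.1 (hPcd ((3 : ℂ) / 2)))
    (fun x hx => (hqa x (hx.1 hx.2)).differentiableAt.differentiableWithinAt) hρ
  -- a NORMALISED Heisenberg package (ed. 1 verbatim)
  obtain ⟨ν, 𝓕, hν, hinv, h𝓕N, h𝓕c, h𝓕1⟩ : ∃ (ν : Measure ↥(adelicUnipotent (↥(maximalRealSubfield L)) L (IsCMField.complexConj L) 3)) (𝓕 : Set ↥(adelicUnipotent (↥(maximalRealSubfield L)) L (IsCMField.complexConj L) 3)), ν.IsHaarMeasure ∧ ν.IsInvInvariant ∧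
      IsFundamentalDomain ↥(rationalUnipotent (↥(maximalRealSubfield L)) L (IsCMField.complexConj L) 3) 𝓕 ν ∧ IsCompact (closure 𝓕) ∧ ν 𝓕 = 1 := by
    obtain ⟨ν, 𝓕, hν, -, -, h𝓕N, h𝓕c, h𝓕0, h𝓕top⟩ :=
      Summit.HodgeConjecture.HodgeConjecture.Cruxes.H413.K2E1SphericalEisensteinStructuralDataCMThree.exists_unipotent_haar_fundamentalDomain_cm_three L
    haveI := hν
    have hc : IsCMField.complexConj L * IsCMField.complexConj L = 1 := AlgEquiv.ext fun x => IsCMField.complexConj_apply_apply L x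
    haveI hν₁ : ((ν 𝓕)⁻¹ • ν).IsHaarMeasure := Measure.IsHaarMeasure.smul ν (ENNReal.inv_ne_zero.2 h𝓕top) (ENNReal.inv_ne_top.2 h𝓕0)
    exact ⟨(ν 𝓕)⁻¹ • ν, 𝓕, hν₁, Summit.HodgeConjecture.HodgeConjecture.Cruxes.H413.K2E1HeisenbergHaarU3.isInvInvariant_of_isHaarMeasure_adelicUnipotent_three hc _,
      h𝓕N.mono smul_absolutelyContinuous, h𝓕c, by rw [Measure.smul_apply, smul_eq_mul, ENNReal.inv_mul_cancel h𝓕0 h𝓕top]⟩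
  haveI := hν
  haveI := hinv
  obtain ⟨i⟩ := hne
  -- the rows BY NAME: `hCONT` (★ p864638 of `hTEXP6`), `hEXP` (★ p864795 of `hCO`), the scalar of record non-vanishing on the tube (★)
  have hCONT := hCONT_tauRow_of_truncatedExportsRow L μ ξ.hψ hTEXP6
  have hEXP := hEXP_tauRow_closed' L μ νG νE h𝓕EN h𝓕Ec h𝓕E0 hβ hμZ μa μf ξ μω hμu hCO
  have hcS0 := scalarRatio_one_ne_zero S T' (isUnitary_bcηInv_mul L ξ hμu)
  have hO : IsOpen {z : ℂ | 1 < z.re} := isOpen_lt continuous_const Complex.continuous_re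
  have hmem : ((3 : ℂ) / 2) ∈ {z : ℂ | 1 < z.re} := by
    show (1 : ℝ) < (((3 : ℂ) / 2)).re
    norm_num
  have hDUPo : IsOpen {z : ℂ | 1 < z.re ∧ 0 < z.im} := (isOpen_lt continuous_const Complex.continuous_re).and (isOpen_lt continuous_const Complex.continuous_im)
  have hDLOo : IsOpen {z : ℂ | 1 < z.re ∧ z.im < 0} := (isOpen_lt continuous_const Complex.continuous_re).and (isOpen_lt Complex.continuous_im continuous_const)
  -- THE τ-SPINE: per τ-level, the τ-atom lies in `L²_res = L²_disc ⊓ (L²_cusp)ᗮ` (closure minimality; no `hW1`)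
  refine resGMidBlockτ_le L μ ξ μω _ fun U₀ hU₀ => ?_
  rw [residualSubspace, toSubmodule_residualPart]
  refine le_inf ((resGMidAtomτ_le_resGMidAtom L μ ξ μω U₀).trans (hdisc_of_admissible L μ ξ μω hDISC (tauLevel L U₀) 1)) ?_
  refine Submodule.topologicalClosure_minimal _ (Submodule.span_le.2 fun f hf => (Submodule.mem_orthogonal _ f).2 fun u hu => ?_) (Submodule.isClosed_orthogonal _)
  obtain ⟨φ, hφV, hφc, hφa, Ec, Sp, hSp, hhol, hEis, Fp, hFp, hFpE, hf⟩ := hf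
  -- the rows of this τ-generator at the normalised package
  obtain ⟨T, hT, S₁, hS₁, Fam, hFd, hFam⟩ := hCONT U₀ hU₀ φ hφV hφc hφa Ec Sp hSp hhol hEis Fp hFp hFpE f hf ν hν 𝓕 h𝓕N h𝓕c hinv h𝓕1
  obtain ⟨hE4, hEbd⟩ := hEXP U₀ hU₀ φ hφV hφc hφa Ec Sp hSp hhol hEis Fp hFp hFpE f hf
  obtain ⟨Ag, M, hAg, hM, hψ2⟩ := hUNF U₀ hU₀ φ hφV hφc hφa Ec Sp hSp hhol hEis Fp hFp hFpE f hf ν hν 𝓕 h𝓕N h𝓕c hinv h𝓕1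
  obtain ⟨Cφ, hφC⟩ := exists_bound_of_mem_chiSectionSpacePair_midBlock L ξ hμu hφV hφc
  obtain ⟨hAgm, hAgB, hAgN⟩ := amplitudeRows_of_unfolding L ξ.hψ (isChiSectionPair_of_mem hφV) hφc hφC Ec hEis ν h𝓕N h𝓕c _ hcS0 Ag hAg hψ2
  -- the columns, the Euler factorisation (★ p864880), the junction near `3∕2` (§1)
  obtain ⟨ι, hι, φ', qv, qcv, Pv, hli, hb, hφ'c, hφ'bd, hqφ, hPvcd, hPvre, hqcvP, hqcvq⟩ := hCOLS U₀ hU₀ φ hφV hφc hφa ν hν 𝓕 h𝓕N h𝓕c hinv h𝓕1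
  obtain ⟨a, ha, hqva⟩ := exists_eulerFactorisation_of_tubeClause L hli hb ν 𝓕 hqφ (hunfK U₀ hU₀ φ hφV hφc hφa ν hν 𝓕 h𝓕N h𝓕c hinv h𝓕1)
  have hr : ∀ j, AnalyticAt ℂ (fun z => a j z / A z) (3 / 2 : ℂ) := fun j =>
    ((ha j).analyticAt (hO.mem_nhds hmem)).div (hA.analyticAt (hO.mem_nhds hmem)) hA32
  have hfacv : ∀ j, ∀ᶠ z in 𝓝[≠] ((3 / 2 : ℂ)), qcv j z = qc z * (a j z / A z) := fun j =>
    eventuallyEq_coord_of_junction hPcd hqa hqcq hA hA32 hsrc hPvcd (hqcvP j) (hqcvq j) (hqva j) (ha j)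
  -- the continued coordinates are holomorphic off `P♯ := Pv ∩ {¬(1 < Re ∧ Im ≠ 0)}` (exports off `Pv`; off-axis exclusion `hPreal`), which misses both quarter planes
  have hoff := hPreal U₀ hU₀ φ hφV hφc hφa ν hν 𝓕 h𝓕N h𝓕c hinv h𝓕1 ι φ' qv qcv Pv hli hb hφ'c hφ'bd hqφ hPvcd hPvre hqcvP hqcvq
  have hqcP : ∀ j, DifferentiableOn ℂ (qcv j) (Pv ∩ {z : ℂ | ¬ (1 < z.re ∧ z.im ≠ 0)})ᶜ := fun j z hz => by
    by_cases hzP : z ∈ Pv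
    · have h' : 1 < z.re ∧ z.im ≠ 0 := by
        by_contra h
        exact hz ⟨hzP, h⟩
      exact (hoff j z h'.1 h'.2).differentiableAt.differentiableWithinAt
    · exact (hqcvP j z hzP).differentiableAt.differentiableWithinAt
  have hsubU : {z : ℂ | 1 < z.re ∧ 0 < z.im} ⊆ (Pv ∩ {z : ℂ | ¬ (1 < z.re ∧ z.im ≠ 0)})ᶜ := fun z hz h => h.2 ⟨hz.1, hz.2.ne'⟩
  have hsubL : {z : ℂ | 1 < z.re ∧ z.im < 0} ⊆ (Pv ∩ {z : ℂ | ¬ (1 < z.re ∧ z.im ≠ 0)})ᶜ := fun z hz h => h.2 ⟨hz.1, hz.2.ne⟩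
  -- hSCAT's package for every `(μ_K, ν_I, 𝓕_I)`: ★ p863697 §2 with the Euler junction; Gram ★ §4; `hreal` the row
  have hscat : ∀ (μK : Measure ↥((standardMaximalCompactGL 3 L).comap (adelicVal (↥(maximalRealSubfield L)) L (IsCMField.complexConj L) 3 ((StdForm.antidiagonal 3).over L)) : Subgroup (quasiSplit (↥(maximalRealSubfield L)) L (IsCMField.complexConj L) 3).Adelic)) (_ : μK.IsHaarMeasure) (νI : Measure (AdeleRing (𝓞 L) L)ˣ) (_ : νI.IsHaarMeasure) (𝓕I : Set (AdeleRing (𝓞 L) L)ˣ) (_ : IsIdeleClassDomain L 𝓕I),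
        ∃ (wc : ℂ → ℂ) (Bc : ℂ → ℂ → ℂ) (d : ℂ → ℂ),
          DifferentiableOn ℂ wc {z : ℂ | 1 < z.re ∧ 0 < z.im} ∧ DifferentiableOn ℂ wc {z : ℂ | 1 < z.re ∧ z.im < 0} ∧ (∀ s : ℂ, 2 < s.re → wc s = ∫ x in {x : (AdeleRing (𝓞 L) L)ˣ | (IdeleClassGroup.ideleNorm L x : ℝ) ≤ 1} ∩ 𝓕I, ((IdeleClassGroup.ideleNorm L x : ℝ) : ℂ) * (((reflectChar (IsCMField.complexConj L) (ξ.bcη⁻¹ * ξ.bcψ⁻¹ * μω) x : ℂˣ) : ℂ) * conj (((ξ.bcη⁻¹ * ξ.bcψ⁻¹ * μω) x : ℂˣ) : ℂ) * (∫ k, (fun g : (quasiSplit (↥(maximalRealSubfield L)) L (IsCMField.complexConj L) 3).Adelic => (∫ v : ↥(adelicUnipotent (↥(maximalRealSubfield L)) L (IsCMField.complexConj L) 3), flatSectionU φ s ((quasiSplit (↥(maximalRealSubfield L)) L (IsCMField.complexConj L) 3).toAdelic (weylLongU ((IsCMField.complexConj L : L ≃ₐ[↥(maximalRealSubfield L)]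 L) : L →+* L) (rfl : (StdForm.antidiagonal 3).over L = (StdForm.antidiagonal 3).over L)) * ((v : (quasiSplit (↥(maximalRealSubfield L)) L (IsCMField.complexConj L) 3).Adelic) * g)) ∂ν) * ((borelHeight g : ℝ) : ℂ) ^ (s - 2)) (k : (quasiSplit (↥(maximalRealSubfield L)) L (IsCMField.complexConj L) 3).Adelic) * conj (φ (k : (quasiSplit (↥(maximalRealSubfield L)) L (IsCMField.complexConj L) 3).Adelic)) ∂μK)) ∂νI) ∧
          (∀ z' ∈ {z : ℂ | 1 < z.re ∧ 0 < z.im}, DifferentiableOn ℂ (fun z : ℂ => Bc z z') {z : ℂ | 1 < z.re ∧ 0 < z.im}) ∧ (∀ z ∈ {z : ℂ | 1 < z.re ∧ 0 < z.im}, DifferentiableOn ℂ (fun u : ℂ => Bc z (conj u)) {u : ℂ | conj u ∈ {z : ℂ | 1 < z.re ∧ 0 < z.im}}) ∧ (∀ z' ∈ {z : ℂ | 1 < z.re ∧ z.im < 0}, DifferentiableOn ℂ (fun z : ℂ => Bc z z') {z : ℂ | 1 < z.re ∧ z.im < 0}) ∧ (∀ z ∈ {z : ℂ | 1 < z.re ∧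 z.im < 0}, DifferentiableOn ℂ (fun u : ℂ => Bc z (conj u)) {u : ℂ | conj u ∈ {z : ℂ | 1 < z.re ∧ z.im < 0}}) ∧ (∀ s s' : ℂ, 2 < s.re → 2 < s'.re → Bc s s' = (∫ x in {x : (AdeleRing (𝓞 L) L)ˣ | (IdeleClassGroup.ideleNorm L x : ℝ) ≤ 1} ∩ 𝓕I, ((IdeleClassGroup.ideleNorm L x : ℝ) : ℂ) ∂νI) * (∫ k, (fun g : (quasiSplit (↥(maximalRealSubfield L)) L (IsCMField.complexConj L) 3).Adelic => (∫ v : ↥(adelicUnipotent (↥(maximalRealSubfield L)) L (IsCMField.complexConj L) 3), flatSectionU φ s ((quasiSplit (↥(maximalRealSubfield L)) L (IsCMField.complexConj L) 3).toAdelic (weylLongU ((IsCMField.complexConj L : L ≃ₐ[↥(maximalRealSubfield L)] L) : L →+* L) (rfl : (StdForm.antidiagonal 3).over L = (StdForm.antidiagonal 3).over L)) * ((v : (quasiSplit (↥(maximalRealSubfield L)) L (IsCMField.complexConj L) 3).Adelic) * g)) ∂ν) * ((borelHeight g : ℝ) : ℂ) ^ (s - 2)) (k : (quasiSplit (↥(maximalRealSubfield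 L)) L (IsCMField.complexConj L) 3).Adelic) * conj ((fun g : (quasiSplit (↥(maximalRealSubfield L)) L (IsCMField.complexConj L) 3).Adelic => (∫ v : ↥(adelicUnipotent (↥(maximalRealSubfield L)) L (IsCMField.complexConj L) 3), flatSectionU φ s' ((quasiSplit (↥(maximalRealSubfield L)) L (IsCMField.complexConj L) 3).toAdelic (weylLongU ((IsCMField.complexConj L : L ≃ₐ[↥(maximalRealSubfield L)] L) : L →+* L) (rfl : (StdForm.antidiagonal 3).over L = (StdForm.antidiagonal 3).over L)) * ((v : (quasiSplit (↥(maximalRealSubfield L)) L (IsCMField.complexConj L) 3).Adelic) * g)) ∂ν) * ((borelHeight g : ℝ) : ℂ) ^ (s' - 2)) (k : (quasiSplit (↥(maximalRealSubfield L)) L (IsCMField.complexConj L) 3).Adelic)) ∂μK)) ∧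
          (AnalyticAt ℂ d (3 / 2 : ℂ)) ∧ (∀ᶠ z in 𝓝[≠] ((3 / 2 : ℂ)), d z = (z - 3 / 2) * wc z) ∧ (∀ᶠ x : ℝ in 𝓝[≠] (3 / 2 : ℝ), (wc (x : ℂ)).im = 0) ∧ (∃ B : ℝ, ∀ᶠ z in 𝓝[≠] ((3 / 2 : ℂ)), ‖z - 3 / 2‖ ^ 2 * ‖Bc z z‖ ≤ B) := by
    intro μK hμK νI hνI 𝓕I h𝓕I
    haveI := hμK
    obtain ⟨wc, Bc, d, h1, h2, h3, h4, h5, h6, h7, h8, h9, h10, h11, h12⟩ :=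
      exists_hSCAT_of_factorisation L μK νI 𝓕I ν h𝓕1 (ξ.bcη⁻¹ * ξ.bcψ⁻¹ * μω) φ φ' hqφ hqcP hqcvq
        hDUPo hsubU hDLOo hsubL
        (fun j => by obtain ⟨C, hC⟩ := hφ'bd j; exact integrable_restrict_mul_conj_of_bounded L μK (hφ'c j) hφc hC hφC)
        (fun j l => by obtain ⟨C, hC⟩ := hφ'bd j; obtain ⟨C', hC'⟩ := hφ'bd l; exact integrable_restrict_mul_conj_of_bounded L μK (hφ'c j) (hφ'c l) hC hC')
        hr hd₀ hd₀q hfacv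
    exact ⟨wc, Bc, d, h1, h2, h3, h4, h5, h6, h7, h8, h9, h10,
      hreal U₀ hU₀ φ hφV hφc hφa ν hν 𝓕 h𝓕N h𝓕c hinv h𝓕1 ι φ' qv qcv Pv hli hb hφ'c hφ'bd hqφ hPvcd hPvre hqcvP hqcvq μK hμK νI hνI 𝓕I h𝓕I wc h12, h11⟩
  -- ROAD (★ p863731 §1), SCAL (★ ed. 1 §1), CT (★ p863518 §1), operator road (★ p863422 §1) — ed. 1 verbatim —, then the seed and the inner product
  obtain ⟨T', hT', D, σ₀, Fam', hDo, hDc, hDsub, hFd', hσ₀, hσD, hD32, hFam', hMS⟩ :=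
    roadData_of_tubeLetters L μ ξ μω hμu hquad hφV hφc Ec hSp hEis ν h𝓕N h𝓕1 h𝓕c hT hS₁ Fam hFd hFam hscat
  obtain ⟨qc', φt, hfacCT, ⟨ρ', hρ'⟩, hφt, hφtm, hφtB, hφtN, C, hφtbd⟩ :=
    scalPackage_of_inputs L φ Ec Sp hhol hE4 hEbd ν h𝓕N h𝓕c q qc hqcq hPcd hqa hρ A hA hA32 _ hsrc Ag hAg hM hψ2 hAgm hAgB hAgN
  obtain ⟨φ₀, ψ, ρψ, hE3, hψ, hψm, hψB, hψN, K, hψK⟩ :=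
    ctPackage_of_scalarRoad L φ Ec Sp ν 𝓕 qc' φt hfacCT hρ' hφt hφtm hφtB hφtN hφtbd
  obtain ⟨T₂, hT₂, D₂, σ₂, Fam₂, corr, hDo₂, hDc₂, hFd₂, hσ₂, hσD₂, hD32₂, hFam₂, hlim, hcorr⟩ :=
    opRoadPackage_of_letters L μ 𝔓 ξ μω i (h𝔓 i) hφV Ec hSp hhol hEis Fp hFp hFpE f hf ν h𝓕N h𝓕c hT' Fam' hDo hDc hDsub hFd' hσ₀ hσD hD32 hFam' hMS
      φ₀ ψ ρψ hE3 hψ hψm hψB hψN hψK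
  exact inner_eq_zero_of_mem_cuspidalSubspace_of_forall_cuspFormsToLp L μ 𝔓 f
    (inner_cuspFormsToLp_eq_zero_of_midResidue_letters L μ 𝔓 Fam₂ hDo₂ hDc₂ hFd₂ hσ₂ hσD₂ hD32₂
      (hseed_of_resGMidAtomGen_clauses L μ ν h𝓕N h𝓕c 𝔓 i (h𝔓 i) ξ hμu hφV hφc Ec hEis hT₂ D₂ Fam₂ hFam₂) f corr hlim hcorr) u hu

end Summit.HodgeConjecture.HodgeConjecture.R90.S8

end
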